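import Literature.Analysis.FunctionSpaces.TorusMollifiedFields
import Literature.Analysis.FunctionSpaces.TimeMollification
import Literature.Analysis.FunctionSpaces.TorusMollifierEstimates
import Literature.Analysis.FunctionSpaces.TorusMollifierAllOrders
import HarnessLib

/-!
# Sup bounds for space–time mollification on `ℝ × T^d`, and the scaled time bumps

Analysis/FunctionSpaces support file (serves the discharge of
`Literature.Barriers.AnomalousDissipation.BuckmasterVicol2019_mollifiedEulerStart`, the
mollification estimates (2.12)–(2.14) of Buckmaster–Vicol, Ann. of Math. 189 (2019), §2.5, for
`v_n = (u ∗ₓ φ_{λ⁻¹}) ∗ₜ ϕ_{λ⁻¹}`). The space–time mollification of a scalar field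
`h : ℝ → T^d → ℝ` by a time kernel `r` and a space kernel `κ` is, in the vocabulary of
`TorusMollifiedFields`, `timeAvgWith r (s ↦ h s ⋆ κ) t x = ∫ r(t - s) ∫ h(s, y) κ(x - y) dy ds`;
every derivative of the mollified velocity and flux of `MollifiedWeakEuler` is of this form with
`r ∈ {ρ, ρ'}` and `κ ∈ {k_ε, ∂ⱼk_ε, ∂ₗ∂ⱼk_ε}`. We prove the one estimate all sup bounds come from:

* `Torus.norm_timeAvgWith_convolution_le_of_window` — **the window bound**: if `r` vanishes off
  `[-τ, τ]`, `κ` vanishes off `{‖z‖ ≤ ε}`, and `|h(s, y)| ≤ B` on the window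
  `|s - t| ≤ τ, ‖y - x‖ ≤ ε`, then `|timeAvgWith r (h ⋆ κ)(t, x)| ≤ (∫|r|)(∫|κ|) B`
  (Evans, App. C.4, Thm. 7: "`|D^α(η_ε ⋆ f)| ≤ ‖D^α η_ε‖_{L¹} sup |f|`", localised); its global
  form `Torus.norm_timeAvgWith_convolution_le_of_bound`, the re-centring identity
  `Torus.timeAvgWith_convolution_sub_const` (`h ↦ h - a` costs `a (∫r)(∫κ)`), by which Hölder
  moduli of `h` enter (Constantin–E–Titi 1994, (6)–(7)), and linearity
  `Torus.timeAvgWith_convolution_sub`;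
* the kernel masses: `∫|∂ⱼk_ε| ≤ C₁ ε⁻¹`, `∫|∂ₗ∂ⱼk_ε| ≤ C₂ ε⁻²` and the supports of `∂ⱼk_ε`,
  `∂ₗ∂ⱼk_ε` (from `TorusMollifier(AllOrders)`), `∫ ∂ⱼk_ε = 0`;
* **the scaled time bumps** `Torus.timeBump hτ : ContDiffBump (0 : ℝ)` (`rIn = τ/2`, `rOut = τ`):
  `timeBump hτ x = timeBump 1 (x/τ)`, hence `(timeBump hτ).normed x = τ⁻¹ (timeBump 1).normed (x/τ)`
  and `∫ |((timeBump hτ).normed)'| = τ⁻¹ ∫ |((timeBump 1).normed)'|` (`Torus.timeBumpDerivMass`),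
  the temporal analogue of `Torus.integral_norm_gradient_kernel`.

## Mathlib / tree search

Tree: `FunctionSpaces.timeAvgWith`, `Torus.kernel`, `Torus.integral_norm_gradient_kernel`,
`Torus.integral_norm_itDeriv_kernel`, `Torus.norm_itDeriv_lineDeriv_le`; the FluidPDE layer
(`OnsagerProofs`, not imported here so that FluidPDE files can import this one) has global-only
time-average and mollification sup bounds; no windowed bound anywhere (searched `window`,
`timeAvgWith` + `closedBall`). Mathlib: `ContDiffBump.apply`,
`ContDiffBump.normed_def`, `MeasureTheory.integral_comp_div`; no scaling family of bumps with a
prescribed outer radius (searched `ContDiffBump` + `smul`/`scale`).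

## References

* T. Buckmaster, V. Vicol, Ann. of Math. 189 (2019), §2.5 (2.12)–(2.14). [`BuckmasterVicol2019Annals`]
* L. C. Evans, *Partial Differential Equations*, 2nd ed. (2010), App. C.4 Thm. 7.
* P. Constantin, W. E, E. S. Titi, Comm. Math. Phys. 165 (1994), (6)–(7).
-/

noncomputable section

open MeasureTheory TopologicalSpace Set Function Filter Metric ContinuousLinearMap
open _root_.Topology
open scoped ENNReal NNReal Convolution ContDiff

namespace Literature.Analysis.FunctionSpaces

namespace Torus

variable {d : Type*} [Fintype d]

/-! ## The window bound -/

section Window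

variable {h : ℝ → UnitAddTorus d → ℝ} {r : ℝ → ℝ} {κ : UnitAddTorus d → ℝ} {A : ℝ}

/-- The convolution integrand `y ↦ h(s, y) κ(x - y)` of a bounded measurable slice against a
continuous kernel is integrable on the torus. [folklore] -/
theorem integrable_mul_kernel_sub (hm : StronglyMeasurable (uncurry h)) (hb : ∀ s y, ‖h s y‖ ≤ A)
    (hκ : Continuous κ) (s : ℝ) (x : UnitAddTorus d) :
    Integrable (fun y => h s y * κ (x - y)) volume := by
  obtain ⟨Cκ, hCκ⟩ := exists_forall_norm_le_of_continuous hκ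
  refine (integrable_const (A * Cκ)).mono'
    ((hm.comp_measurable (measurable_const.prodMk measurable_id)).aestronglyMeasurable.mul
      (hκ.comp (continuous_const.sub continuous_id)).aestronglyMeasurable)
    (Eventually.of_forall fun y => ?_)
  rw [norm_mul]
  exact mul_le_mul (hb s y) (hCκ _) (norm_nonneg _) ((norm_nonneg _).trans (hb s y))

/-- The space–time mollification as an iterated integral:
`timeAvgWith r (h ⋆ κ)(t, x) = ∫ r(t - s) ∫ h(s, y) κ(x - y) dy ds`. [folklore] -/
theorem timeAvgWith_convolution_eq_integral (t : ℝ) (x : UnitAddTorus d) :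
    timeAvgWith r (fun s => h s ⋆ κ) t x = ∫ s, r (t - s) * ∫ y, h s y * κ (x - y) := by
  rw [timeAvgWith_eq_integral_sub]
  refine integral_congr_ae (Eventually.of_forall fun s => ?_)
  simp only [smul_eq_mul, convolution_def, lsmul_apply]

/-- **The window bound for space–time mollification.** Let `r` vanish off `[-τ, τ]`, let `κ`
be continuous and vanish off `{‖z‖ ≤ ε}`, and let `h` be bounded and strongly measurable on
`ℝ × T^d` (no integrability is needed: the Bochner integral of a non-integrable slice is `0`)
with `|h(s, y)| ≤ B` whenever `|s - t| ≤ τ` and `‖y - x‖ ≤ ε`. Then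
`|timeAvgWith r (h ⋆ κ)(t, x)| ≤ (∫|r|)(∫|κ|) B` (Evans, App. C.4, Thm. 7, localised: only the
window around `(t, x)` is seen by the kernels). [folklore] -/
theorem norm_timeAvgWith_convolution_le_of_window (hr : Integrable r volume) {τ : ℝ}
    (hrτ : ∀ σ, τ < |σ| → r σ = 0) (hκ : Continuous κ) {ε : ℝ} (hκε : ∀ z, ε < ‖z‖ → κ z = 0)
    {t : ℝ} {x : UnitAddTorus d} {B : ℝ}
    (hB : ∀ s y, |s - t| ≤ τ → ‖y - x‖ ≤ ε → ‖h s y‖ ≤ B) :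
    ‖timeAvgWith r (fun s => h s ⋆ κ) t x‖ ≤ (∫ σ, ‖r σ‖) * (∫ z, ‖κ z‖) * B := by
  rw [timeAvgWith_convolution_eq_integral]
  -- the inner integral on the window
  have hinner : ∀ s, |s - t| ≤ τ → ‖∫ y, h s y * κ (x - y)‖ ≤ (∫ z, ‖κ z‖) * B := by
    intro s hs
    have hpt : ∀ y, ‖h s y * κ (x - y)‖ ≤ B * ‖κ (x - y)‖ := by
      intro y
      rw [norm_mul]
      by_cases hy : ‖y - x‖ ≤ ε
      · exact mul_le_mul_of_nonneg_right (hB s y hs hy) (norm_nonneg _)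
      · have : κ (x - y) = 0 := hκε _ (by rwa [← norm_neg, neg_sub, ← not_le])
        simp [this]
    calc ‖∫ y, h s y * κ (x - y)‖ ≤ ∫ y, B * ‖κ (x - y)‖ :=
          norm_integral_le_of_norm_le (((hκ.comp (continuous_const.sub continuous_id)).norm
            |>.integrable_unitAddTorus).const_mul B) (Eventually.of_forall hpt)
      _ = (∫ z, ‖κ z‖) * B := by
          rw [integral_const_mul, integral_sub_left_eq_self (fun z => ‖κ z‖) volume x, mul_comm]
  -- the outer integral
  have hpt : ∀ s, ‖r (t - s) * ∫ y, h s y * κ (x - y)‖ ≤ ‖r (t - s)‖ * ((∫ z, ‖κ z‖) * B) := by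
    intro s
    rw [norm_mul]
    by_cases hs : |s - t| ≤ τ
    · exact mul_le_mul_of_nonneg_left (hinner s hs) (norm_nonneg _)
    · have : r (t - s) = 0 := hrτ _ (by rw [abs_sub_comm]; exact lt_of_not_ge hs)
      simp [this]
  have hrt : Integrable (fun s => r (t - s)) volume := hr.comp_sub_left t
  calc ‖∫ s, r (t - s) * ∫ y, h s y * κ (x - y)‖ ≤ ∫ s, ‖r (t - s)‖ * ((∫ z, ‖κ z‖) * B) :=
        norm_integral_le_of_norm_le (hrt.norm.mul_const _) (Eventually.of_forall hpt)
    _ = (∫ σ, ‖r σ‖) * (∫ z, ‖κ z‖) * B := by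
        rw [integral_mul_const, integral_sub_left_eq_self (fun σ => ‖r σ‖) volume t, mul_assoc]

/-- **The global bound**: `|timeAvgWith r (h ⋆ κ)(t, x)| ≤ (∫|r|)(∫|κ|) A` for `|h| ≤ A`
(Evans, App. C.4, Thm. 7 (iii)). [folklore] -/
theorem norm_timeAvgWith_convolution_le_of_bound
    (hb : ∀ s y, ‖h s y‖ ≤ A) (hr : Integrable r volume) (hκ : Continuous κ) (t : ℝ)
    (x : UnitAddTorus d) :
    ‖timeAvgWith r (fun s => h s ⋆ κ) t x‖ ≤ (∫ σ, ‖r σ‖) * (∫ z, ‖κ z‖) * A := by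
  rw [timeAvgWith_convolution_eq_integral]
  have hinner : ∀ s, ‖∫ y, h s y * κ (x - y)‖ ≤ (∫ z, ‖κ z‖) * A := by
    intro s
    have hpt : ∀ y, ‖h s y * κ (x - y)‖ ≤ A * ‖κ (x - y)‖ := fun y => by
      rw [norm_mul]
      exact mul_le_mul_of_nonneg_right (hb s y) (norm_nonneg _)
    calc ‖∫ y, h s y * κ (x - y)‖ ≤ ∫ y, A * ‖κ (x - y)‖ :=
          norm_integral_le_of_norm_le (((hκ.comp (continuous_const.sub continuous_id)).norm
            |>.integrable_unitAddTorus).const_mul A) (Eventually.of_forall hpt)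
      _ = (∫ z, ‖κ z‖) * A := by
          rw [integral_const_mul, integral_sub_left_eq_self (fun z => ‖κ z‖) volume x, mul_comm]
  have hpt : ∀ s, ‖r (t - s) * ∫ y, h s y * κ (x - y)‖ ≤ ‖r (t - s)‖ * ((∫ z, ‖κ z‖) * A) := fun s => by
    rw [norm_mul]
    exact mul_le_mul_of_nonneg_left (hinner s) (norm_nonneg _)
  have hrt : Integrable (fun s => r (t - s)) volume := hr.comp_sub_left t
  calc ‖∫ s, r (t - s) * ∫ y, h s y * κ (x - y)‖ ≤ ∫ s, ‖r (t - s)‖ * ((∫ z, ‖κ z‖) * A) :=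
        norm_integral_le_of_norm_le (hrt.norm.mul_const _) (Eventually.of_forall hpt)
    _ = (∫ σ, ‖r σ‖) * (∫ z, ‖κ z‖) * A := by
        rw [integral_mul_const, integral_sub_left_eq_self (fun σ => ‖r σ‖) volume t, mul_assoc]

/-- **Re-centring**: subtracting a constant from `h` changes the space–time mollification by
`a (∫r)(∫κ)`: `timeAvgWith r ((h - a) ⋆ κ)(t, x) = timeAvgWith r (h ⋆ κ)(t, x) - a (∫r)(∫κ)`.
[folklore] -/
theorem timeAvgWith_convolution_sub_const (hm : StronglyMeasurable (uncurry h))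
    (hb : ∀ s y, ‖h s y‖ ≤ A) (hr : Integrable r volume) (hκ : Continuous κ) (a : ℝ) (t : ℝ)
    (x : UnitAddTorus d) :
    timeAvgWith r (fun s => (fun y => h s y - a) ⋆ κ) t x =
      timeAvgWith r (fun s => h s ⋆ κ) t x - a * ((∫ σ, r σ) * ∫ z, κ z) := by
  obtain ⟨Cκ, hCκ⟩ := exists_forall_norm_le_of_continuous hκ
  have hA : 0 ≤ A := (norm_nonneg _).trans (hb t x)
  rw [timeAvgWith_convolution_eq_integral, timeAvgWith_convolution_eq_integral]
  have hκi : Integrable (fun y => κ (x - y)) volume :=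
    (hκ.comp (continuous_const.sub continuous_id)).integrable_unitAddTorus
  -- the inner integrals
  have hinner : ∀ s, ∫ y, (h s y - a) * κ (x - y) = (∫ y, h s y * κ (x - y)) - a * ∫ z, κ z := by
    intro s
    have h1 : (fun y => (h s y - a) * κ (x - y)) = fun y => h s y * κ (x - y) - a * κ (x - y) := by
      funext y; ring
    rw [h1, integral_sub (integrable_mul_kernel_sub hm hb hκ s x) (hκi.const_mul a),
      integral_const_mul, integral_sub_left_eq_self (fun z => κ z) volume x]
  have hstep : (fun s => r (t - s) * ∫ y, (h s y - a) * κ (x - y)) =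
      fun s => r (t - s) * (∫ y, h s y * κ (x - y)) - r (t - s) * (a * ∫ z, κ z) := by
    funext s
    rw [hinner s, mul_sub]
  rw [hstep]
  -- integrability in time of the two pieces
  have hrt : Integrable (fun s => r (t - s)) volume := hr.comp_sub_left t
  have hI1 : Integrable (fun s => r (t - s) * ∫ y, h s y * κ (x - y)) volume := by
    have hjm : StronglyMeasurable (uncurry fun s y => h s y * κ (x - y)) :=
      hm.mul (hκ.comp (continuous_const.sub continuous_snd)).stronglyMeasurable
    have hbd : ∀ s, ‖∫ y, h s y * κ (x - y)‖ ≤ A * Cκ := fun s => by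
      refine (norm_integral_le_of_norm_le (integrable_const (A * Cκ))
        (Eventually.of_forall fun y => ?_)).trans (by simp)
      rw [norm_mul]
      exact mul_le_mul (hb s y) (hCκ _) (norm_nonneg _) hA
    exact hrt.mul_bdd hjm.integral_prod_right'.aestronglyMeasurable (Eventually.of_forall hbd)
  have hI2 : Integrable (fun s => r (t - s) * (a * ∫ z, κ z)) volume := hrt.mul_const _
  rw [integral_sub hI1 hI2, integral_mul_const, integral_sub_left_eq_self (fun σ => r σ) volume t]
  ring

/-- **Linearity**: the space–time mollification of a difference of two bounded measurable fields
is the difference of the mollifications (integral formula, slice by slice). [folklore] -/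
theorem timeAvgWith_convolution_sub {h₁ h₂ : ℝ → UnitAddTorus d → ℝ} {A₁ A₂ : ℝ}
    (hm₁ : StronglyMeasurable (uncurry h₁)) (hb₁ : ∀ s y, ‖h₁ s y‖ ≤ A₁)
    (hm₂ : StronglyMeasurable (uncurry h₂)) (hb₂ : ∀ s y, ‖h₂ s y‖ ≤ A₂)
    (hr : Integrable r volume) (hκ : Continuous κ) (t : ℝ) (x : UnitAddTorus d) :
    timeAvgWith r (fun s => (fun y => h₁ s y - h₂ s y) ⋆ κ) t x =
      timeAvgWith r (fun s => h₁ s ⋆ κ) t x - timeAvgWith r (fun s => h₂ s ⋆ κ) t x := by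
  obtain ⟨Cκ, hCκ⟩ := exists_forall_norm_le_of_continuous hκ
  have hA₁ : 0 ≤ A₁ := (norm_nonneg _).trans (hb₁ t x)
  have hA₂ : 0 ≤ A₂ := (norm_nonneg _).trans (hb₂ t x)
  rw [timeAvgWith_convolution_eq_integral, timeAvgWith_convolution_eq_integral,
    timeAvgWith_convolution_eq_integral]
  have hinner : ∀ s, ∫ y, (h₁ s y - h₂ s y) * κ (x - y) =
      (∫ y, h₁ s y * κ (x - y)) - ∫ y, h₂ s y * κ (x - y) := by
    intro s
    have h1 : (fun y => (h₁ s y - h₂ s y) * κ (x - y)) =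
        fun y => h₁ s y * κ (x - y) - h₂ s y * κ (x - y) := by
      funext y; ring
    rw [h1, integral_sub (integrable_mul_kernel_sub hm₁ hb₁ hκ s x) (integrable_mul_kernel_sub hm₂ hb₂ hκ s x)]
  have hstep : (fun s => r (t - s) * ∫ y, (h₁ s y - h₂ s y) * κ (x - y)) =
      fun s => r (t - s) * (∫ y, h₁ s y * κ (x - y)) - r (t - s) * ∫ y, h₂ s y * κ (x - y) := by
    funext s; rw [hinner s, mul_sub]
  rw [hstep]
  have hrt : Integrable (fun s => r (t - s)) volume := hr.comp_sub_left t
  have hI : ∀ {h : ℝ → UnitAddTorus d → ℝ} {A : ℝ}, StronglyMeasurable (uncurry h) →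
      (∀ s y, ‖h s y‖ ≤ A) → 0 ≤ A → Integrable (fun s => r (t - s) * ∫ y, h s y * κ (x - y)) volume := by
    intro h A hm hb hA
    have hjm : StronglyMeasurable (uncurry fun s y => h s y * κ (x - y)) :=
      hm.mul (hκ.comp (continuous_const.sub continuous_snd)).stronglyMeasurable
    have hbd : ∀ s, ‖∫ y, h s y * κ (x - y)‖ ≤ A * Cκ := fun s => by
      refine (norm_integral_le_of_norm_le (integrable_const (A * Cκ))
        (Eventually.of_forall fun y => ?_)).trans (by simp)
      rw [norm_mul]
      exact mul_le_mul (hb s y) (hCκ _) (norm_nonneg _) hA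
    exact hrt.mul_bdd hjm.integral_prod_right'.aestronglyMeasurable (Eventually.of_forall hbd)
  rw [integral_sub (hI hm₁ hb₁ hA₁) (hI hm₂ hb₂ hA₂)]

end Window

/-! ## The derivatives of the torus kernel: supports and masses -/

section KernelFacts

variable [DecidableEq d] {ε : ℝ}

/-- `∂ⱼ k_ε` vanishes off `{‖z‖ ≤ ε}` (`0 < ε ≤ 1/4`). [folklore] -/
theorem partialDeriv_kernel_eq_zero (hε : 0 < ε) (hε' : ε ≤ 1 / 4) (j : d) {z : UnitAddTorus d}
    (hz : ε < ‖z‖) : partialDeriv j (kernel ε) z = 0 := by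
  have h := abs_partialDeriv_le_norm_gradient ((isSmooth_kernel (d := d) hε hε').isContDiff (by simp)) z j
  rw [gradient_kernel_eq_zero hε hε' hz, norm_zero] at h
  exact abs_nonpos_iff.1 h

/-- `∫ |∂ⱼ k_ε| ≤ C₁ ε⁻¹` (`0 < ε ≤ 1/4`). [folklore] -/
theorem integral_norm_partialDeriv_kernel_le (hε : 0 < ε) (hε' : ε ≤ 1 / 4) (j : d) :
    ∫ z, ‖partialDeriv j (kernel (d := d) ε) z‖ ≤ ε⁻¹ * gradProfileMass d := by
  rw [← integral_norm_gradient_kernel hε hε']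
  exact integral_mono ((isSmooth_kernel hε hε').partialDeriv j).continuous.norm.integrable_unitAddTorus
    (continuous_gradient_kernel hε hε').norm.integrable_unitAddTorus fun z =>
    abs_partialDeriv_le_norm_gradient ((isSmooth_kernel (d := d) hε hε').isContDiff (by simp)) z j

/-- `∫ ∂ⱼ k_ε = 0` (no boundary on the torus). [folklore] -/
theorem integral_partialDeriv_kernel (hε : 0 < ε) (hε' : ε ≤ 1 / 4) (j : d) :
    ∫ z, partialDeriv j (kernel (d := d) ε) z = 0 :=
  integral_partialDeriv_eq_zero_holds (isSmooth_kernel hε hε') j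

/-- `|∂ₗ∂ⱼ k_ε (z)| ≤ ‖D² k_ε (z)‖`. [folklore] -/
theorem norm_partialDeriv_partialDeriv_kernel_le (hε : 0 < ε) (hε' : ε ≤ 1 / 4) (l j : d)
    (z : UnitAddTorus d) :
    ‖partialDeriv l (partialDeriv j (kernel ε)) z‖ ≤ ‖itDeriv 2 (kernel (d := d) ε) z‖ := by
  have hk := isSmooth_kernel (d := d) hε hε'
  have h1 : ‖partialDeriv l (partialDeriv j (kernel ε)) z‖ ≤
      ‖itDeriv 1 (partialDeriv j (kernel (d := d) ε)) z‖ := by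
    have h := norm_itDeriv_lineDeriv_le (hk.partialDeriv j) 0 (EuclideanSpace.single l (1 : ℝ)) z
    rw [norm_itDeriv_zero, PiLp.norm_single, norm_one, one_mul] at h
    exact h
  have h2 : ‖itDeriv 1 (partialDeriv j (kernel (d := d) ε)) z‖ ≤ ‖itDeriv 2 (kernel (d := d) ε) z‖ := by
    have h := norm_itDeriv_lineDeriv_le hk 1 (EuclideanSpace.single j (1 : ℝ)) z
    rw [PiLp.norm_single, norm_one, one_mul] at h
    exact h
  exact h1.trans h2

/-- `∂ₗ∂ⱼ k_ε` vanishes off `{‖z‖ ≤ ε}` (`0 < ε ≤ 1/4`). [folklore] -/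
theorem partialDeriv_partialDeriv_kernel_eq_zero (hε : 0 < ε) (hε' : ε ≤ 1 / 4) (l j : d)
    {z : UnitAddTorus d} (hz : ε < ‖z‖) : partialDeriv l (partialDeriv j (kernel ε)) z = 0 := by
  have h := norm_partialDeriv_partialDeriv_kernel_le hε hε' l j z
  rw [itDeriv_kernel_eq_zero hε hε' 2 (hz.trans_le (norm_le_norm_reprc z)), norm_zero] at h
  exact norm_le_zero_iff.1 h

/-- `∫ |∂ₗ∂ⱼ k_ε| ≤ C₂ ε⁻²` (`0 < ε ≤ 1/4`). [folklore] -/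
theorem integral_norm_partialDeriv_partialDeriv_kernel_le (hε : 0 < ε) (hε' : ε ≤ 1 / 4) (l j : d) :
    ∫ z, ‖partialDeriv l (partialDeriv j (kernel (d := d) ε)) z‖ ≤ (ε ^ 2)⁻¹ * derivProfileMass d 2 := by
  rw [← integral_norm_itDeriv_kernel hε hε' 2]
  exact integral_mono
    (((isSmooth_kernel hε hε').partialDeriv j).partialDeriv l).continuous.norm.integrable_unitAddTorus
    (continuous_itDeriv_kernel hε hε' 2).norm.integrable_unitAddTorus
    (norm_partialDeriv_partialDeriv_kernel_le hε hε' l j)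

omit [DecidableEq d] in
/-- `k_ε` vanishes off `{‖z‖ ≤ ε}` (strict form of `kernel_eq_zero_of_le`). [folklore] -/
theorem kernel_eq_zero_of_lt (hε : 0 < ε) {z : UnitAddTorus d} (hz : ε < ‖z‖) :
    kernel (d := d) ε z = 0 :=
  kernel_eq_zero_of_le hε hz.le

omit [DecidableEq d] in
/-- `∫ |k_ε| = 1`. [folklore] -/
theorem integral_norm_kernel_eq_one (hε : 0 < ε) (hε' : ε ≤ 1 / 4) : ∫ z, ‖kernel (d := d) ε z‖ = 1 :=
  (integral_congr_ae (Eventually.of_forall fun z => by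
    simp [Real.norm_eq_abs, abs_of_nonneg (kernel_nonneg hε.le z)])).trans (integral_kernel hε hε')

end KernelFacts

/-! ## The scaled time bumps -/

section TimeBump

/-- **The scaled time bumps** `ρ_τ`: the Mathlib bump on `ℝ` centred at `0` with inner radius
`τ/2` and outer radius `τ`, `0 < τ` (Buckmaster–Vicol 2019, §2.5: "a family of standard Friedrichs
mollifiers … on `ℝ` (time)", `ϕ_τ(s) = τ⁻¹ϕ(s/τ)` after normalisation). [cite: BuckmasterVicol2019Annals, §2.5] -/
def timeBump {τ : ℝ} (hτ : 0 < τ) : ContDiffBump (0 : ℝ) :=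
  ⟨τ / 2, τ, by positivity, by linarith⟩

variable {τ : ℝ} (hτ : 0 < τ)

/-- The outer radius of `ρ_τ` is `τ`. [folklore] -/
@[simp]
theorem timeBump_rOut : (timeBump hτ).rOut = τ := rfl

/-- The inner radius of `ρ_τ` is `τ/2`. [folklore] -/
@[simp]
theorem timeBump_rIn : (timeBump hτ).rIn = τ / 2 := rfl

/-- **Scaling of the bumps**: `timeBump hτ x = timeBump 1 (x/τ)`. [folklore] -/
theorem timeBump_apply (x : ℝ) : timeBump hτ x = timeBump one_pos (x / τ) := by
  rw [ContDiffBump.apply, ContDiffBump.apply, timeBump_rOut, timeBump_rIn, timeBump_rOut, timeBump_rIn]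
  have h1 : τ / (τ / 2) = (1 : ℝ) / (1 / 2) := by field_simp
  have h2 : (τ / 2)⁻¹ • (x - 0) = ((1 : ℝ) / 2)⁻¹ • (x / τ - 0) := by
    simp only [sub_zero, smul_eq_mul]
    field_simp
  rw [h1, h2]

/-- `∫ timeBump hτ = τ ∫ timeBump 1`. [folklore] -/
theorem integral_timeBump : ∫ x, timeBump hτ x = τ * ∫ x, timeBump one_pos x := by
  simp_rw [timeBump_apply hτ]
  rw [MeasureTheory.Measure.integral_comp_div (fun x => timeBump one_pos x) τ, abs_of_pos hτ, smul_eq_mul]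

/-- **Scaling of the normalised bumps**: `(timeBump hτ).normed x = τ⁻¹ (timeBump 1).normed (x/τ)`. [folklore] -/
theorem timeBump_normed_apply (x : ℝ) :
    (timeBump hτ).normed volume x = τ⁻¹ * (timeBump one_pos).normed volume (x / τ) := by
  rw [ContDiffBump.normed_def, ContDiffBump.normed_def, integral_timeBump hτ, timeBump_apply hτ]
  field_simp

/-- The derivative of the scaled normalised bump:
`((timeBump hτ).normed)'(x) = τ⁻² ((timeBump 1).normed)'(x/τ)`. [folklore] -/
theorem deriv_timeBump_normed (x : ℝ) :
    deriv ((timeBump hτ).normed volume) x = τ⁻¹ * τ⁻¹ * deriv ((timeBump one_pos).normed volume) (x / τ) := by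
  have hfun : ((timeBump hτ).normed volume : ℝ → ℝ) =
      fun x => τ⁻¹ * (timeBump one_pos).normed volume (x / τ) := funext (timeBump_normed_apply hτ)
  have hd : Differentiable ℝ ((timeBump one_pos).normed volume) :=
    ((timeBump one_pos).contDiff_normed (n := 1)).differentiable one_ne_zero
  rw [hfun]
  have h1 : HasDerivAt (fun x => (timeBump one_pos).normed volume (x / τ))
      (deriv ((timeBump one_pos).normed volume) (x / τ) * τ⁻¹) x := by
    have h := (hd (x / τ)).hasDerivAt.comp x ((hasDerivAt_id x).div_const τ)
    convert h using 1 <;> first | rfl | rw [one_div]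
  rw [(h1.const_mul τ⁻¹).deriv]
  ring

/-- The `L¹` mass of the derivative of the unit normalised bump, `c = ∫ |((timeBump 1).normed)'|`. [folklore] -/
def timeBumpDerivMass : ℝ :=
  ∫ x, ‖deriv ((timeBump one_pos).normed volume) x‖

/-- `0 ≤ c`. [folklore] -/
theorem timeBumpDerivMass_nonneg : 0 ≤ timeBumpDerivMass :=
  integral_nonneg fun _ => norm_nonneg _

/-- **`τ ∫ |ρ_τ'| = c`**: the `L¹` mass of the derivative of the scaled normalised bump is
`τ⁻¹ c`. [folklore] -/
theorem integral_norm_deriv_timeBump_normed :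
    ∫ x, ‖deriv ((timeBump hτ).normed volume) x‖ = τ⁻¹ * timeBumpDerivMass := by
  simp_rw [deriv_timeBump_normed hτ, norm_mul, Real.norm_eq_abs, abs_inv, abs_of_pos hτ]
  rw [integral_const_mul,
    MeasureTheory.Measure.integral_comp_div (fun x => |deriv ((timeBump one_pos).normed volume) x|) τ,
    abs_of_pos hτ, smul_eq_mul, timeBumpDerivMass]
  simp_rw [Real.norm_eq_abs]
  field_simp

/-- The scaled normalised bump and its derivative vanish off `[-τ, τ]`. [folklore] -/
theorem timeBump_normed_eq_zero {σ : ℝ} (hσ : τ < |σ|) :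
    (timeBump hτ).normed volume σ = 0 ∧ deriv ((timeBump hτ).normed volume) σ = 0 := by
  have hopen : IsOpen {x : ℝ | τ < |x|} := isOpen_lt continuous_const continuous_abs
  have hzero : ∀ x : ℝ, τ < |x| → (timeBump hτ).normed volume x = 0 := fun x hx =>
    normed_eq_zero_of_rOut_le_abs (timeBump hτ) (by rw [timeBump_rOut]; exact hx.le)
  have hev : ((timeBump hτ).normed volume : ℝ → ℝ) =ᶠ[𝓝 σ] fun _ => 0 := by
    filter_upwards [hopen.mem_nhds hσ] with x hx
    exact hzero x hx
  refine ⟨hzero σ hσ, ?_⟩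
  rw [hev.deriv_eq, deriv_const]

/-- `∫ |ρ_τ| = 1`. [folklore] -/
theorem integral_norm_timeBump_normed : ∫ x, ‖(timeBump hτ).normed volume x‖ = 1 := by
  rw [← (timeBump hτ).integral_normed (μ := volume)]
  exact integral_congr_ae (Eventually.of_forall fun x => by
    simp [Real.norm_eq_abs, abs_of_nonneg ((timeBump hτ).nonneg_normed x)])

/-- The derivative of the scaled normalised bump is integrable (twin, for `φ := timeBump hτ`, of
`FluidPDE.Torus.integrable_deriv_normed` of `MollifiedWeakEuler`, which lives above this file). [folklore] -/
theorem integrable_deriv_timeBump_normed : Integrable (deriv ((timeBump hτ).normed volume)) volume :=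
  (((timeBump hτ).contDiff_normed (μ := volume) (n := 1)).continuous_deriv le_rfl).integrable_of_hasCompactSupport
    (timeBump hτ).hasCompactSupport_normed.deriv

end TimeBump

end Torus

end Literature.Analysis.FunctionSpaces

end
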